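import Summits.ResolutionOfSingularities.ResolutionOfSingularities.Theorems.EquisingularLiftEquisingularLiftNatNoseDescRung
import Summits.ResolutionOfSingularities.ResolutionOfSingularities.Theorems.EquisingularLiftEquisingularLiftNatNoseDescSharpEngine
import Summits.ResolutionOfSingularities.ResolutionOfSingularities.Theorems.EquisingularLiftEquisingularLiftNatLargeCharRoof
import HarnessLib

/-!
# [OURS · L1 W4.5(b) · EL♮(3) · D18♯ «SMOOTH-PARAMETER DESCENT DOOR», rung row] RUNG^{D18♯} ★★ `nose_descSharp_rung_three`
# `(T-k) → p.Prime → ∀ k … → NoseHypHostedNestEquinodalDirectCILiftTowerZeroPrimeSigmaPGBTriplePrimeDescSharp₂ k 3 H ι → ELNatConclusionO k 3 H ι`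
# (binder = RUNG^{D18} ✓ `nose_desc_rung_three`'s VERBATIM, blob E10 ↦ blob E11) and the ISO-side rung `iso_descSharp_rung` (any `n`, Fact-free)

leafhand-res-equisingularlift-1 g0 (prover, 2026-08-30; one-generation line-first hand on stmt-ResolutionOfSingularities-20148 / -20038).
Blob E11 = res-type-027's ✓ `…NatResidueHypDefsE11` (p732739): the TOP-LEVEL disjunction «✓ blob E10
`NoseHypHostedNestEquinodalDirectCILiftTowerZeroPrimeSigmaPGBTriplePrimeDesc₂ k n H ι` ∨ `DescDoorSharp k n H ι`» (idea-2 D18-WIDENINGS v1.1 §2.1).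
Arm 1 = ✓ RUNG^{D18} `nose_desc_rung_three` (…NatNoseDescRung, res-L1-w45b-nose-w1 g8, p741397) VERBATIM — it consumes (T-k);
arm 2 = ★★ `descDoorSharp_elnat` (…NatNoseDescSharpEngine, this hand, p793810) — FACT-FREE, any `n`, no hypothesis on `H`.
So the booked D18♯ REPLACE «¬blob_E10 ↦ ¬blob_E11» of the nose residue
`stub_elnat_three_nonisolated_nonUnobsNonEquinodalDirectCINestNoseLiftTowerZeroPrimeSigmaPGBTriplePrimeDesc` (53rd registration, CHILD
9ca743c009ed75dc / PARENT df9c8b289aa4be52) is now TEXTS-ONLY: derived body `by_cases hE11 : blob_E11; · nose_descSharp_rung_three p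
stub_elnat_embeddedCurveLiftFact hp k H ι hι hH hloc hE11; · <new residue> … hE11`, REPLACE lemma ✓
`not_noseHypHostedNestEquinodalDirectCILiftTowerZeroPrimeSigmaPGBTriplePrimeDesc₂_of_not_descSharp₂`; and the drawer D19-ISO ADD
«… → ¬IsoHypReachNDLeavesP9 → ¬DescDoorSharp → ELNatConclusionO» of the iso residue `stub_elnat_three_isolated_nonNDLeaves9` is texts-only over
`iso_descSharp_rung` below.  AND the ENGINE WEIGHT (B7) `hengine` of res-type-027 g26's ✓ LC-ROOF `LargeChar.elnatLargeChar_of_spread_of_engine`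
(…NatLargeCharRoof; idea-2 LARGE-CHAR-RUNG (B6)/(B7)) is DISCHARGED: `LargeChar.elnatLargeChar_of_spread` = the roof with ONE weight left, the SPREAD
`hspread` ((B3′)–(B5)).  A registration still needs the desk's germ gate (R84 AMENDED / R95 (3)(d5): a certified customer in D18♯ ∖ D18;
candidate generic `𝔅_{6,c}`, R96 (3)) — this file does not register anything.
OURS; NOT a statement of any manuscript ([Hironaka2017] is a candidate under adjudication, nothing of it is asserted); AI-written, weaker than
expert review.  No `sorry`; standard axioms; DEF-FREE; the ONLY named hypothesis is (T-k) `EmbeddedCurveLiftFact` (the skeleton's DERIVED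
`stub_elnat_embeddedCurveLiftFact`, a tree theorem since the 45th registration), needed by arm 1 only.
`--supports stmt-ResolutionOfSingularities-20148 --as helper`, counted 0.  EL♮(3) is NOT proved here; resolution of singularities in positive
characteristic is NOT proved anywhere in this tree (dim 3 in print: Cossart–Piltant 2008/2009). [folklore; pure composition of ✓ modules]
-/

set_option linter.dupNamespace false -- mandated namespace `Summit.<Summit>.<Problem>` of this single-conjunct summit

noncomputable section

open CategoryTheory CategoryTheory.Limits AlgebraicGeometry TopologicalSpace Topology
open Summit.ResolutionOfSingularities.ResolutionOfSingularities.Theses.EquisingularLift.Split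
open Summit.ResolutionOfSingularities.ResolutionOfSingularities.Cruxes.EquisingularLift.StrataSplit

namespace Summit.ResolutionOfSingularities.ResolutionOfSingularities.Cruxes.EquisingularLiftNat.Sections

/-- ★★ **THE RUNG (R-D18♯) `nose_descSharp_rung_three`: surfaces `H ⊂ ℙ³_k` satisfying blob E11 = «blob E10 ∨ DescDoorSharp» (res-type-027's
✓ `NoseHypHostedNestEquinodalDirectCILiftTowerZeroPrimeSigmaPGBTriplePrimeDescSharp₂`) satisfy EL♮(3)'s conclusion, GIVEN (T-k).**  = ONE `Or`
case split: the E10 arm is ✓ `nose_desc_rung_three` verbatim (desk kit call shape `nose_descSharp_rung_three p stub_elnat_embeddedCurveLiftFact hp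
k H ι hι hH hloc hE11`), the D18♯ arm is ★★ `descDoorSharp_elnat p hp k 3 H ι` (Fact-free).
[OURS · L1 W4.5b · rung of the booked REPLACE «¬blob_E10 ↦ ¬blob_E11»; NOT a statement of the manuscript; EL♮(3) NOT proved] -/
theorem nose_descSharp_rung_three (p : ℕ) : EmbeddedCurveLiftFact → p.Prime →
    ∀ (k : Type) [Field k] [CharP k p] [IsAlgClosed k] (H : AlgebraicGeometry.Scheme.{0})
    (ι : H ⟶ (Literature.AlgebraicGeometry.Motives.projectiveSpace 3 k).left),
    AlgebraicGeometry.IsClosedImmersion ι → AlgebraicGeometry.IsIntegral H →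
    (∀ y : (Literature.AlgebraicGeometry.Motives.projectiveSpace 3 k).left,
      ∃ U : (Literature.AlgebraicGeometry.Motives.projectiveSpace 3 k).left.affineOpens,
        y ∈ (U : (Literature.AlgebraicGeometry.Motives.projectiveSpace 3 k).left.Opens) ∧ (ι.ker.ideal U).IsPrincipal) →
    NoseHypHostedNestEquinodalDirectCILiftTowerZeroPrimeSigmaPGBTriplePrimeDescSharp₂ k 3 H ι → ELNatConclusionO k 3 H ι := by
  intro hF hp k _ _ _ H ι hι hH hloc hE
  rcases hE with h10 | hS
  · exact nose_desc_rung_three p hF hp k H ι hι hH hloc h10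
  · exact descDoorSharp_elnat p hp k 3 H ι hS

/-- **The ISO-side rung (any `n`, Fact-free; drawer D19-ISO, desk R95 (3)):** in the binder order of the isolated residue's rungs
(`p`, `p.Prime`, `k`, `n`, `H`, `ι`, `hι`, `hH`, `hloc`, then the door), `DescDoorSharp k n H ι → ELNatConclusionO k n H ι` — the three crux
hypotheses are NOT used (the engine needs none); they are carried so that an ADD-form text can call
`iso_descSharp_rung p hp k n H ι hι hH hloc hS` in the kit's shape. [OURS · L1 W4.5b · pure composition; EL♮(3) NOT proved] -/
theorem iso_descSharp_rung (p : ℕ) (hp : p.Prime) (k : Type) [Field k] [CharP k p] [IsAlgClosed k] (n : ℕ)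
    (H : AlgebraicGeometry.Scheme.{0}) (ι : H ⟶ (Literature.AlgebraicGeometry.Motives.projectiveSpace n k).left)
    (_hι : AlgebraicGeometry.IsClosedImmersion ι) (_hH : AlgebraicGeometry.IsIntegral H)
    (_hloc : ∀ y : (Literature.AlgebraicGeometry.Motives.projectiveSpace n k).left,
      ∃ U : (Literature.AlgebraicGeometry.Motives.projectiveSpace n k).left.affineOpens,
        y ∈ (U : (Literature.AlgebraicGeometry.Motives.projectiveSpace n k).left.Opens) ∧ (ι.ker.ideal U).IsPrincipal)
    (hS : DescDoorSharp k n H ι) : ELNatConclusionO k n H ι :=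
  descDoorSharp_elnat p hp k n H ι hS

/-- **The 53rd nose residue FOLLOWS from the would-be 54th (D18♯) residue** — the REPLACE step as one implication, so that a lead's derived
body is a one-liner: if every `H` outside blob E11 reaches the conclusion, then every `H` outside blob E10 does (case split on
`DescDoorSharp`). Hypothesis prefix = the registered nose residue's, VERBATIM up to the last binder. [OURS · pure logic] -/
theorem nose_residue_desc_of_descSharp (p : ℕ)
    (h54 : p.Prime → ∀ (k : Type) [Field k] [CharP k p] [IsAlgClosed k] (n : ℕ) (H : AlgebraicGeometry.Scheme.{0})
      (ι : H ⟶ (Literature.AlgebraicGeometry.Motives.projectiveSpace n k).left),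
      AlgebraicGeometry.IsClosedImmersion ι → AlgebraicGeometry.IsIntegral H →
      (∀ y : (Literature.AlgebraicGeometry.Motives.projectiveSpace n k).left,
        ∃ U : (Literature.AlgebraicGeometry.Motives.projectiveSpace n k).left.affineOpens,
          y ∈ (U : (Literature.AlgebraicGeometry.Motives.projectiveSpace n k).left.Opens) ∧ (ι.ker.ideal U).IsPrincipal) →
      n = 3 → ¬ Literature.AlgebraicGeometry.Resolution.Scheme.IsRegular H →
      ¬ Set.Finite {x : H | ¬ IsRegularLocalRing (H.presheaf.stalk x)} →
      ¬ NoseHypCI k n H ι → ¬ NoseHypDet k n H ι → ¬ NoseHypLiftClass k n H ι → ¬ NoseHypLiftClassTwo k n H ι →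
      ¬ (ReachNoseTower₄ k n H ι) → ¬ (ReachNoseTower₇ k n H ι) → ¬ (ReachNoseTowerB k n H ι) → ¬ (ReachNoseTowerBPrime k n H ι) →
      ¬ (ReachNoseTowerBDoublePrime k n H ι) → ¬ (ReachNoseTowerBTriplePrime k n H ι) → ¬ NoseHypUnobsBTriplePrime k n H ι →
      ¬ NoseHypHostedNestEquinodalDirectCILiftTowerZeroPrimeSigmaPGBTriplePrimeDescSharp₂ k n H ι → ELNatConclusionO k n H ι) :
    p.Prime → ∀ (k : Type) [Field k] [CharP k p] [IsAlgClosed k] (n : ℕ) (H : AlgebraicGeometry.Scheme.{0})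
      (ι : H ⟶ (Literature.AlgebraicGeometry.Motives.projectiveSpace n k).left),
      AlgebraicGeometry.IsClosedImmersion ι → AlgebraicGeometry.IsIntegral H →
      (∀ y : (Literature.AlgebraicGeometry.Motives.projectiveSpace n k).left,
        ∃ U : (Literature.AlgebraicGeometry.Motives.projectiveSpace n k).left.affineOpens,
          y ∈ (U : (Literature.AlgebraicGeometry.Motives.projectiveSpace n k).left.Opens) ∧ (ι.ker.ideal U).IsPrincipal) →
      n = 3 → ¬ Literature.AlgebraicGeometry.Resolution.Scheme.IsRegular H →
      ¬ Set.Finite {x : H | ¬ IsRegularLocalRing (H.presheaf.stalk x)} →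
      ¬ NoseHypCI k n H ι → ¬ NoseHypDet k n H ι → ¬ NoseHypLiftClass k n H ι → ¬ NoseHypLiftClassTwo k n H ι →
      ¬ (ReachNoseTower₄ k n H ι) → ¬ (ReachNoseTower₇ k n H ι) → ¬ (ReachNoseTowerB k n H ι) → ¬ (ReachNoseTowerBPrime k n H ι) →
      ¬ (ReachNoseTowerBDoublePrime k n H ι) → ¬ (ReachNoseTowerBTriplePrime k n H ι) → ¬ NoseHypUnobsBTriplePrime k n H ι →
      ¬ NoseHypHostedNestEquinodalDirectCILiftTowerZeroPrimeSigmaPGBTriplePrimeDesc₂ k n H ι → ELNatConclusionO k n H ι := by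
  intro hp k _ _ _ n H ι hι hH hloc h3 hHreg hinf hnci hndet hlc hlc2 ht4 ht7 htB htBP htBPP htBT hunobs hE10
  by_cases hS : DescDoorSharp k n H ι
  · exact descDoorSharp_elnat p hp k n H ι hS
  · exact h54 hp k n H ι hι hH hloc h3 hHreg hinf hnci hndet hlc hlc2 ht4 ht7 htB htBP htBPP htBT hunobs
      (fun hE11 => hE11.elim hE10 hS)

end Summit.ResolutionOfSingularities.ResolutionOfSingularities.Cruxes.EquisingularLiftNat.Sections

namespace Summit.ResolutionOfSingularities.ResolutionOfSingularities.Cruxes.EquisingularLiftNat.Sections.LargeChar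

open Literature.AlgebraicGeometry.Resolution

/-- ★★ **LC-ROOF WITH THE ENGINE WEIGHT FUNDED — `elnatLargeChar_of_spread`.**  res-type-027 g26's ✓ `elnatLargeChar_of_spread_of_engine`
(idea-2 g32 LARGE-CHAR-RUNG (B6), binder list v2) with its second weight `hengine` («`DescDoorSharp k n H ι → ELNatConclusionO k n H ι` in every
prime characteristic», (B7)) DISCHARGED by ★★ `descDoorSharp_elnat` (…NatNoseDescSharpEngine, p793810): **from the SPREAD weight alone —
✓ `DescDoorSharp` for the universal degree-`d` member at every geometric point of a basic open around every characteristic-zero point of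
`Spec ℤ[c]` ((B3′)–(B5), still UNFUNDED architecture) — there is `M = M(n, d)` such that for every prime `p > M`, every algebraically closed `k` of
characteristic `p` and every degree-`d` form `F` cut out by `ι : H ⟶ ℙⁿ_k` in the sense of `Cut`, `ELNatConclusionO k n H ι` holds.**  A RUNG in
the degree — NOT EL♮(3), NOT a route to `closes` (crit-3 g14's honest reading stands); `Cut` is the composer's schema binder as in the roof.
[OURS · L1 W4.5b · pure composition · counted 0 · EL♮(3) NOT proved] [folklore] -/
theorem elnatLargeChar_of_spread (n d : ℕ)
    (Cut : ∀ (k : Type) [Field k] (H : AlgebraicGeometry.Scheme.{0}),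
      (H ⟶ (Literature.AlgebraicGeometry.Motives.projectiveSpace n k).left) → MvPolynomial (Fin (n + 1)) k → Prop)
    (hspread : ∀ 𝔮 : Ideal (CoeffRingP n d), 𝔮.IsPrime → (∀ q : ℕ, q.Prime → (q : CoeffRingP n d) ∉ 𝔮) →
      ∃ f ∉ 𝔮, ∀ 𝔭 : Ideal (CoeffRingP n d), 𝔭.IsPrime → 𝔮 ≤ 𝔭 → f ∉ 𝔭 →
        ∀ (k : Type) [Field k] [IsAlgClosed k] (θ : CoeffRingP n d →+* k), RingHom.ker θ = 𝔭 →
          ∀ (H : AlgebraicGeometry.Scheme.{0}) (ι : H ⟶ (Literature.AlgebraicGeometry.Motives.projectiveSpace n k).left),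
            Cut k H ι (univHyp n d θ) → DescDoorSharp k n H ι) :
    ∃ M : ℕ, ∀ (p : ℕ), p.Prime → ∀ (k : Type) [Field k] [CharP k p] [IsAlgClosed k], M < p →
      ∀ (H : AlgebraicGeometry.Scheme.{0}) (ι : H ⟶ (Literature.AlgebraicGeometry.Motives.projectiveSpace n k).left)
        (F : MvPolynomial (Fin (n + 1)) k), F.IsHomogeneous d → Cut k H ι F → ELNatConclusionO k n H ι :=
  elnatLargeChar_of_spread_of_engine n d Cut hspread (fun p hp k _ _ _ H ι => descDoorSharp_elnat p hp k n H ι)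

end Summit.ResolutionOfSingularities.ResolutionOfSingularities.Cruxes.EquisingularLiftNat.Sections.LargeChar

end
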